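/-
Copyright: cell pub-balaban-gaps (YM BLITZ Y1, track G1), seat g1-p2 GEN 7 (unit `pub-balaban-gaps-g1-p2`).  Row (D4) NODE O,
JUNCTION J-3′ (part 2): [B9] Cor. 3.5's step AT `U = 1` ON THE GENUINE one-scale flat propagator of the lit-balaban B6 lineage
(letters: part 1 `D4WalkBlockFlatLetters`; step: `D4WalkBlockDerivative`) — for every (3.61)-dominated holomorphic perturbation `V`,
`G′_K(1 − VG′_K)⁻¹` is a block walk expansion with derivative letters, constants uniform in `K` and the volume.  HONEST FRAMING: flat
operator = the tree's scalar model (`U = 1`); `V` a hypothesis SHAPE; (D4) NOT discharged (instance 0∕1); NOT BetaPertH, NOT continuum, NOT Clay.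
-/
import Summits.QuantumFields.BalabanUV.Gaps.D4WalkBlockDerivative
import Summits.QuantumFields.BalabanUV.Gaps.D4WalkBlockFlatLetters

/-!
# `Gaps.D4WalkBlockFlatOneScale` — Cor. 3.5's step at `U = 1` on the genuine one-scale flat propagator
# (cell pub-balaban-gaps, seat g1-p2 gen 7)

HONEST DEPENDENCY (cell pub-balaban, verbatim): continuum YM on T⁴ ⇐ BetaPertH ∧ nine spine estimates (0/9 proved);
BetaPertH ⇐ (D1) ∧ (D4) ∧ CAP+tail.

`D4WalkBlockFlatLetters.flatLetters_oneScaleTorus` (value + derivative block letters of `G′_K = (−Δ^η + m² + a_KQ′_K*Q′_K)⁻¹`, k- and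
volume-uniform, from `B6Prop22OneScaleTorus.entries_oneScaleTorus`) + `D4WalkBlockFlatLetters.blockWalkExpansion_const` (the one-term
expansion) + `D4WalkBlockDerivative.blockWalkExpansion_perturb_of_derivLetters` ⟹ **`blockWalkExpansion_flatPerturb_oneScaleTorus`**.
References: T. Bałaban, Comm. Math. Phys. **99** (1985) 389–434 [B9], Cor. 3.5 p. 407, (3.60)–(3.65) pp. 402–403; Comm. Math. Phys.
**96** (1984) 223–250 [4], Prop. 2.2 (2.67) p. 234; Comm. Math. Phys. **116** (1988) 1–22 [II], (1.11) p. 5.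
-/

noncomputable section

namespace Summit.QuantumFields.BalabanUV.Gaps.D4WalkBlockFlatOneScale

open Metric Set Finset
open scoped Matrix
open Literature.MathematicalPhysics.QuantumFieldTheory.Balaban1983to89
open Literature.MathematicalPhysics.QuantumFieldTheory.Balaban1983to89.B9SectDWalk (DomBy)
open Literature.MathematicalPhysics.QuantumFieldTheory.Balaban1983to89.B9Thm34Ext (toB6)
open Literature.MathematicalPhysics.QuantumFieldTheory.Balaban1983to89.B9Thm37GlueTorus (torusGeom tdist1 tdist1_nonneg)
open Literature.MathematicalPhysics.QuantumFieldTheory.Balaban1983to89.TreeLengthTorus (TPt)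
open Literature.MathematicalPhysics.QuantumFieldTheory.Balaban1983to89.B5TorusCover (UT)
open Literature.MathematicalPhysics.QuantumFieldTheory.Balaban1983to89.B11SectG (RowSum)
open Literature.MathematicalPhysics.QuantumFieldTheory.Balaban1983to89.B5Ineq137Torus (Nv)
open Literature.MathematicalPhysics.QuantumFieldTheory.Balaban1983to89.B6Prop22OneScaleTorus (Index)
open Literature.MathematicalPhysics.QuantumFieldTheory.Balaban1983to89.B1RG242Torus (tower deriv)
open Summit.QuantumFields.BalabanUV.Gaps.D4WalkBlock (blockNorm BlockWalkExpansion)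
open Summit.QuantumFields.BalabanUV.Gaps.D4WalkBlockDerivative (blockWalkExpansion_perturb_of_derivLetters)
open Summit.QuantumFields.BalabanUV.Gaps.D4WalkBlockFlatLetters
  (cubeOf flatLetters_oneScaleTorus blockWalkExpansion_const map_ofReal_mul)

section Step

variable {d L : ℕ} {a msq : ℝ}
variable {dd N' : ℕ} {E : Type*} [NormedAddCommGroup E] [NormedSpace ℂ E]

/-- **[B9] COR. 3.5's STEP AT `U = 1` ON THE GENUINE ONE-SCALE FLAT PROPAGATOR — k- AND VOLUME-UNIFORM.**  There are `δ₀, C > 0`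
(B6's, functions of `d, L, a, m²` only) such that for EVERY member `i : Index d L` of the one-scale torus family (every `K ≥ 1`, every
volume), with `Gc = ((tower i.P a m²).G K).map ofReal` (the complexified flat `G′_K = (−Δ^η + m² + a_KQ′_K*Q′_K)⁻¹`) and
`∇c_μ = (∂^η_μ).map ofReal`: for every σ-independent entrywise-holomorphic perturbation `V(u)` on a ball with the (3.61)-shape
domination letter `‖V(u)S‖_{Y,Y′} ≤ α₀‖S‖_{Y,Y′} + Σ_μ α_μ‖∇c_μS‖_{Y,Y′}` (`α ≥ 0`), every cube row sum `(μ, c_μ)` of the cube torus and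
rates `0 ≤ μ`, `2μ ≤ ε`, `2μ ≤ ½δ₀ − ε − μ`, and the MARGIN `c_μ(c_μ·1·(1·((α₀ + Σ_μ α_μ·1)C))c_μ)c_μ < 1` («α₁ sufficiently small»
against `(C, c_μ)` ONLY): `Gc(1 − V(u)Gc)⁻¹` — the walk-expansion content of (3.64) `G′(U′) = G′(1)(I − V′G′(1))⁻¹` — is a block walk
expansion at `(ε − 2μ, ½δ₀ − ε − 3μ)`, walk rate `½δ₀ − 2μ`, constant `c_μC(1·(1−q)⁻¹)c_μ`, with dominating distances and the
relative derivative letters `1` for the `∇c_μ` — no constant depends on `K`, the volume, or `‖∇‖ = O(L^K)`; the input expansion is the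
ONE-TERM `blockWalkExpansion_const` of `Gc` at walk rate `½δ₀` with the letters of `flatLetters_oneScaleTorus`.
[cite: Balaban1985BackgroundPropagators, Cor. 3.5 p.407, (3.60)–(3.65) pp.402–403, p.399, Thm 3.1 (3.42) p.397, (3.107)–(3.108) p.416; Balaban1984PropagatorsII, Prop. 2.2 (2.67) p.234; Balaban1988RG2Cluster, (1.11) p.5] -/
theorem blockWalkExpansion_flatPerturb_oneScaleTorus (hd : 1 ≤ d) (hL : Odd L ∧ 1 < L) (ha : 0 < a) (hmsq : 0 ≤ msq) :
    ∃ δ₀ C : ℝ, 0 < δ₀ ∧ 0 < C ∧ ∀ (i : Index d L) (c₀ : B13.Consts) (X : Finset (UT (Nv i.P i.P.K))) (R : ℝ)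
      (V : E → Matrix (Site i.P 0) (Site i.P 0) ℂ) (α₀ : ℝ) (α : Fin i.P.d → ℝ) (ε μ cμ : ℝ),
      (∀ j k, DifferentiableOn ℂ (fun u => V u j k) (ball (0 : E) R)) → 0 ≤ α₀ → (∀ ν, 0 ≤ α ν) →
      (∀ u ∈ ball (0 : E) R, ∀ (S : Matrix (Site i.P 0) (Site i.P 0) ℂ) (Y Y' : UT (Nv i.P i.P.K)),
        blockNorm (cubeOf i.P) (cubeOf i.P) (V u * S) Y Y' ≤
          α₀ * blockNorm (cubeOf i.P) (cubeOf i.P) S Y Y' +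
            ∑ ν, α ν * blockNorm (cubeOf i.P) (cubeOf i.P) ((deriv i.P 0 i.P.eps ν).map ((↑) : ℝ → ℂ) * S) Y Y') →
      0 ≤ μ → 2 * μ ≤ ε → 2 * μ ≤ δ₀ / 2 - ε - μ → 0 ≤ cμ →
      RowSum (toB6 (torusGeom (Nv i.P i.P.K) 0 0 0) 0 True) μ cμ →
      cμ * (cμ * 1 * (1 * ((α₀ + ∑ ν, α ν * 1) * C)) * cμ) * cμ < 1 →
      ∃ (W : Type) (T : W → (TPt dd N' → ℂ) → E → Matrix (Site i.P 0) (Site i.P 0) ℂ) (SX' : Set W) (A' : W → ℝ)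
        (D' : W → UT (Nv i.P i.P.K) → UT (Nv i.P i.P.K) → ℝ),
        BlockWalkExpansion c₀ (cubeOf i.P) (cubeOf i.P)
          (fun (_ : TPt dd N' → ℂ) u => ((tower i.P a msq).G i.P.K).map ((↑) : ℝ → ℂ) *
            (1 - V u * ((tower i.P a msq).G i.P.K).map ((↑) : ℝ → ℂ))⁻¹) X R
          (ε - 2 * μ) (δ₀ / 2 - ε - μ - 2 * μ)
          (cμ * C * (1 * (1 - cμ * (cμ * 1 * (1 * ((α₀ + ∑ ν, α ν * 1) * C)) * cμ) * cμ)⁻¹) * cμ)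
          T SX' A' D' (δ₀ / 2 - 2 * μ) ∧
        (∀ (ν : Fin i.P.d) ω (σ : TPt dd N' → ℂ), (∀ j, ‖σ j‖ ≤ Real.exp c₀.κ₁) → ∀ u ∈ ball (0 : E) R, ∀ Y Y',
          blockNorm (cubeOf i.P) (cubeOf i.P) ((deriv i.P 0 i.P.eps ν).map ((↑) : ℝ → ℂ) * T ω σ u) Y Y' ≤
            1 * (A' ω * Real.exp (-((δ₀ / 2 - 2 * μ) * D' ω Y Y')))) ∧
        ∀ ω, DomBy (toB6 (torusGeom (Nv i.P i.P.K) 0 0 0) 0 True) (D' ω) := by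
  obtain ⟨δ₀, C, hδ₀, hC, hflat⟩ := flatLetters_oneScaleTorus d L hd hL ha hmsq
  refine ⟨δ₀, C, hδ₀, hC, fun i c₀ X R V α₀ α ε μ cμ hVan hα₀ hα hV hμ hμε hμκ hcμ hrow hq => ?_⟩
  -- the flat propagator as a one-term expansion at walk rate ½δ₀, window ε, torus rate ½δ₀ − ε − μ
  have hW := blockWalkExpansion_const (dd := dd) (N' := N') (E := E) c₀ (cubeOf i.P) X
    (((tower i.P a msq).G i.P.K).map ((↑) : ℝ → ℂ)) R (ε := ε) (κ := δ₀ / 2 - ε - μ) (ρ := δ₀ / 2) hC.le (by linarith)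
    (fun Y Y' => (hflat i Y Y').1)
  -- its derivative letters, relative factor 1
  have hD : ∀ (ν : Fin i.P.d) (ω : Unit) (σ : TPt dd N' → ℂ), (∀ j, ‖σ j‖ ≤ Real.exp c₀.κ₁) → ∀ u ∈ ball (0 : E) R,
      ∀ Y Y' : UT (Nv i.P i.P.K),
        blockNorm (cubeOf i.P) (cubeOf i.P)
            ((deriv i.P 0 i.P.eps ν).map ((↑) : ℝ → ℂ) * ((tower i.P a msq).G i.P.K).map ((↑) : ℝ → ℂ)) Y Y' ≤
          1 * (C * Real.exp (-(δ₀ / 2 * tdist1 (Nv i.P i.P.K) Y Y'))) := by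
    intro ν _ σ _ u _ Y Y'
    rw [one_mul, ← map_ofReal_mul]
    exact (hflat i Y Y').2 ν
  exact blockWalkExpansion_perturb_of_derivLetters (Dop := fun ν => (deriv i.P 0 i.P.eps ν).map ((↑) : ℝ → ℂ))
    (B := fun _ => (1 : ℝ)) hW (fun _ Y Y' => le_rfl) (fun _ => zero_le_one) hD hVan hα₀ hα hV hμ hμε hμκ (by linarith)
    hC.le hcμ hrow hq

end Step

end Summit.QuantumFields.BalabanUV.Gaps.D4WalkBlockFlatOneScale

end
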